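import Mathlib
import Summits.MatrixMultiplication.MatrixMultiplication.Theorems.SubgroupIdentityDesigns.Negative.FlagCharacter
import Summits.MatrixMultiplication.MatrixMultiplication.Theorems.SubgroupIdentityDesigns.Negative.FlagTwist
import Summits.MatrixMultiplication.MatrixMultiplication.Theorems.SubgroupIdentityDesigns.Negative.FlagTwistFamily
import Summits.MatrixMultiplication.MatrixMultiplication.Theorems.SubgroupIdentityDesigns.Negative.WitnessWindow

/-!
# Exact degree of the level-one principal series: `[GL_{1+l}(F) : P_1] · (q - 1) = q^{1+l} - 1`
(support lemma for the crux `SubgroupIdentityDesigns`, stmt-MatrixMultiplication-14079; cell B2b-5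
`b2b-lgcu-borel`, gen 11 — report `run/shared/lean/b2b/levelgraded-cu/ORACLE-g11.md` §G11-3d)

`FlagDegree` / `FlagTwistNoGo.twChar_one_ge` bound the degree of the twisted flag characters
`Ψ_S = Ind_{P'}^G λ_S` from BELOW by `p^{kl + k(k-1)/2}`.  For `k = 1` the flag stabiliser
`P' = flagStab F 1 l` is the stabiliser of the LINE `⟨e_0⟩` in the (transitive) action of
`G = GL_{1+l}(F)` on the projective space `ℙ(F^{1+l})` (`flagStab_one_eq_stabilizer`,
`isPretransitive_proj`), so orbit–stabiliser and `Projectivization.card` give the EXACT index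
`[G : P'] · (q - 1) = q^{1+l} - 1` (`index_flagStab_one_mul`) and the exact degree of every level-one
principal-series character, `Ψ_S(1) · (p - 1) = p^{1+l} - 1` (`twChar_one_mul_level_one`), i.e.
`Ψ_S(1) = (p^m - 1)/(p - 1) = [m]_p`, the number of points of `ℙ^{m-1}(𝔽_p)`.  This replaces the floor
`p^{m-1}` by `[m]_p ≈ p^{m-1} · p/(p-1)` in the level-one budget bound (`budget_ge_levelOne`:
`budget(p, m, 1, s) ≥ (p-2) [m]_p^s`) and sharpens the uniform level-one squeeze of
`Negative/WitnessWindow.lean` (there: no level-one witness for `p ≥ 17`, small `ε`) to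
`no_levelOne_witness_sharp`: NO level-one witness of the crux in any `GL_m(𝔽_p)`, `m ≥ 2`, for every
prime `p ≥ 7` and all `0 < ε ≤ ε₁'(p)` (`ε₁'(7) ≈ 0.009`, `ε₁'(13) ≈ 0.12`), via the elementary
inequality `p^m ≤ (p²/(p+1)) [m]_p` (`m ≥ 2`).  The level-one witness window thus shrinks to
`p ∈ {2, 3, 5}` (where `p - 2 ≤ 3` family members cannot outweigh the wall ceiling) plus, for each
`p ≥ 7`, the band `ε > ε₁'(p)`.
Sorry-free.  VALUE = exact constant + uniform no-go theorem, NOT summit progress; the crux item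
(stmt-MatrixMultiplication-14079) stays open.
-/

set_option linter.dupNamespace false

noncomputable section

open scoped BigOperators Matrix Classical

namespace Summit.MatrixMultiplication.MatrixMultiplication.Theorems.SubgroupIdentityDesigns.Negative
namespace LevelOneDegree

open FlagCharacter (flagStab mem_flagStab_iff')
open FlagTwist (twChar twChar_one)

section General

variable {F : Type} [Field F] [Fintype F] [DecidableEq F] {l : ℕ}

omit [Fintype F] [DecidableEq F] in
/-- The first standard basis vector `e_0` of `F^{1+l}` is non-zero. -/
theorem single_ne_zero : (Pi.single (Fin.castAdd l (0 : Fin 1)) (1 : F) : Fin (1 + l) → F) ≠ 0 := by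
  intro h
  have := congr_fun h (Fin.castAdd l (0 : Fin 1))
  simp at this

omit [Fintype F] [DecidableEq F] in
/-- The action of `g ∈ GL_{1+l}(F)` on `e_0` is the `0`-th column of `g`. -/
theorem smul_single_apply (g : GL (Fin (1 + l)) F) (i : Fin (1 + l)) :
    (g • (Pi.single (Fin.castAdd l (0 : Fin 1)) (1 : F) : Fin (1 + l) → F)) i =
      (g : Matrix (Fin (1 + l)) (Fin (1 + l)) F) i (Fin.castAdd l 0) := by
  rw [Units.smul_def, Matrix.smul_eq_mulVec, Matrix.mulVec_single_one]
  rfl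

omit [Fintype F] in
/-- Every index of `Fin (1 + l)` other than `castAdd l 0` is a `natAdd 1 i`. -/
theorem eq_natAdd_of_ne {i : Fin (1 + l)} (hi : i ≠ Fin.castAdd l (0 : Fin 1)) :
    ∃ i' : Fin l, i = Fin.natAdd 1 i' := by
  have h1 : 1 ≤ (i : ℕ) := by
    rcases Nat.eq_zero_or_pos (i : ℕ) with h | h
    · exact absurd (Fin.ext (by rw [Fin.val_castAdd]; exact h)) hi
    · exact h
  have h2 := i.isLt
  refine ⟨⟨(i : ℕ) - 1, by omega⟩, Fin.ext ?_⟩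
  simp only [Fin.natAdd_mk]
  omega

omit [Fintype F] in
/-- **`P' = Stab(⟨e_0⟩)`**: for `k = 1` the flag stabiliser is the stabiliser of the line through
`e_0` in the action of `GL_{1+l}(F)` on `ℙ(F^{1+l})`. -/
theorem flagStab_one_eq_stabilizer :
    flagStab F 1 l = MulAction.stabilizer (GL (Fin (1 + l)) F)
      (Projectivization.mk F (Pi.single (Fin.castAdd l (0 : Fin 1)) (1 : F) : Fin (1 + l) → F)
        (single_ne_zero (F := F) (l := l))) := by
  ext g
  rw [MulAction.mem_stabilizer_iff, Projectivization.smul_mk, Projectivization.mk_eq_mk_iff,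
    mem_flagStab_iff']
  constructor
  · rintro ⟨hlow, -⟩
    -- the `0`-th column of `g` is `g₀₀ • e_0` with `g₀₀ ≠ 0`
    have hcol : ∀ i : Fin (1 + l), i ≠ Fin.castAdd l 0 →
        (g : Matrix (Fin (1 + l)) (Fin (1 + l)) F) i (Fin.castAdd l 0) = 0 := by
      intro i hi
      obtain ⟨i', rfl⟩ := eq_natAdd_of_ne hi
      exact hlow i' 0
    have h00 : (g : Matrix (Fin (1 + l)) (Fin (1 + l)) F) (Fin.castAdd l 0) (Fin.castAdd l 0) ≠ 0 := by
      intro h0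
      have hzero : ∀ i, (g : Matrix (Fin (1 + l)) (Fin (1 + l)) F) i (Fin.castAdd l 0) = 0 := by
        intro i
        by_cases hi : i = Fin.castAdd l 0
        · rw [hi]; exact h0
        · exact hcol i hi
      have hdet : (g : Matrix (Fin (1 + l)) (Fin (1 + l)) F).det = 0 :=
        Matrix.det_eq_zero_of_column_eq_zero (Fin.castAdd l 0) hzero
      exact (Matrix.GeneralLinearGroup.det_ne_zero g) hdet
    refine ⟨Units.mk0 _ h00, ?_⟩
    ext i
    rw [smul_single_apply, Pi.smul_apply, Units.smul_mk0, smul_eq_mul]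
    by_cases hi : i = Fin.castAdd l 0
    · subst hi; simp
    · rw [hcol i hi, Pi.single_eq_of_ne hi, mul_zero]
  · rintro ⟨a, ha⟩
    refine ⟨fun i j => ?_, fun i j hij => absurd hij (by
      rw [Subsingleton.elim i j]; exact lt_irrefl _)⟩
    rw [Subsingleton.elim j 0]
    have := congr_fun ha (Fin.natAdd 1 i)
    rw [smul_single_apply, Pi.smul_apply] at this
    rw [← this, Pi.single_eq_of_ne (fun h => ?_), smul_zero]
    have := congr_arg Fin.val h
    simp at this

variable (F) in
omit [Fintype F] [DecidableEq F] in
/-- `GL_n(F)` acts transitively on `ℙ(F^n)` (transported from `LinearMap.GeneralLinearGroup`). -/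
theorem isPretransitive_proj (n : ℕ) :
    MulAction.IsPretransitive (GL (Fin n) F) (Projectivization F (Fin n → F)) := by
  haveI : MulAction.IsPretransitive (LinearMap.GeneralLinearGroup F (Fin n → F))
      (Projectivization F (Fin n → F)) := MulAction.isPretransitive_of_is_two_pretransitive
  refine ⟨fun x y => ?_⟩
  obtain ⟨e, he⟩ := MulAction.exists_smul_eq (LinearMap.GeneralLinearGroup F (Fin n → F)) x y
  refine ⟨Matrix.GeneralLinearGroup.toLin.symm e, ?_⟩
  rw [← he, ← Projectivization.mk_rep x, Projectivization.smul_mk, Projectivization.smul_mk]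
  congr 1
  have key : ∀ (A : GL (Fin n) F) (v : Fin n → F),
      ((Matrix.GeneralLinearGroup.toLin A : LinearMap.GeneralLinearGroup F (Fin n → F)) :
        (Fin n → F) →ₗ[F] (Fin n → F)) v = (A : Matrix (Fin n) (Fin n) F) *ᵥ v := fun A v => by
    rw [Matrix.GeneralLinearGroup.coe_toLin, Matrix.mulVecLin_apply]
  rw [Units.smul_def, Matrix.smul_eq_mulVec]
  change _ = ((e : LinearMap.GeneralLinearGroup F (Fin n → F)) : (Fin n → F) →ₗ[F] (Fin n → F)) x.rep
  rw [← key, MulEquiv.apply_symm_apply]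

/-- **EXACT INDEX**: `[GL_{1+l}(F) : P_1] · (q - 1) = q^{1+l} - 1`. -/
theorem index_flagStab_one_mul :
    (flagStab F 1 l).index * (Fintype.card F - 1) = Fintype.card F ^ (1 + l) - 1 := by
  haveI := isPretransitive_proj F (1 + l)
  rw [flagStab_one_eq_stabilizer, MulAction.index_stabilizer_of_transitive]
  have h := Projectivization.card (k := F) (V := Fin (1 + l) → F)
  rw [Nat.card_eq_fintype_card (α := Fin (1 + l) → F), Fintype.card_fun, Fintype.card_fin,
    Nat.card_eq_fintype_card (α := F)] at h
  exact h.symm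

end General

section ZModP

open Summit.MatrixMultiplication.MatrixMultiplication.Theorems.LieRankDesigns.Negative (GLm)

variable {p : ℕ} [hp : Fact p.Prime] {l : ℕ}

/-- **Exact degree of the level-one principal series**: for every `χ : Fin 1 → MulChar (𝔽_p) ℂ` the
twisted flag character satisfies `Ψ_χ(1) · (p - 1) = p^{1+l} - 1`, i.e. `Ψ_χ(1) = [1+l]_p`. -/
theorem twChar_one_mul_level_one (χ : Fin 1 → MulChar (ZMod p) ℂ) :
    (twChar (l := l) χ 1).re * ((p : ℝ) - 1) = (p : ℝ) ^ (1 + l) - 1 := by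
  rw [twChar_one]
  simp only [Complex.natCast_re]
  have h := index_flagStab_one_mul (F := ZMod p) (l := l)
  rw [ZMod.card, Subgroup.index_eq_card, Nat.card_eq_fintype_card] at h
  have hp1 : 1 ≤ p := hp.out.one_le
  have hpow : 1 ≤ p ^ (1 + l) := Nat.one_le_pow _ _ hp.out.pos
  have hc : ((Fintype.card (GL (Fin (1 + l)) (ZMod p) ⧸ flagStab (ZMod p) 1 l) * (p - 1) : ℕ) : ℝ)
      = ((p ^ (1 + l) - 1 : ℕ) : ℝ) := by rw [h]
  rw [Nat.cast_mul, Nat.cast_sub hp1, Nat.cast_sub hpow] at hc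
  push_cast at hc
  exact hc

/-! ## The exact level-one floor and the sharpened uniform squeeze -/

open Literature.RepresentationTheory.FiniteGroups
open Literature.Barriers.MatrixMultiplication (SubgroupTPP)
open Summit.MatrixMultiplication.MatrixMultiplication.Theorems.LieRankDesigns.Negative
  (Mat levelSet budget re_apply_one_nonneg)
open FlagTwist (twChar_mem_levelSet)
open FlagTwistNorm (isIrrChar_twChar)
open FlagTwistFamily (tup tup_injective tup_ne_one twChar_ne_of_ne psi)
open PrincipalSeriesBudget (card_mulChar)
open WitnessWindow (window card_rankLE_one_mul_le)

/-- **EXACT LEVEL-ONE FLOOR**: `budget(p, 1+l, 1, s) ≥ (p − 2) · [1+l]_p^s` (every real `s`), where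
`[1+l]_p = (p^{1+l} − 1)/(p − 1)` is the exact degree of the `p − 2` level-one principal-series
characters `Ψ_χ` (`χ ≠ 1`). -/
theorem budget_ge_levelOne (s : ℝ) :
    ((p : ℝ) - 2) * (((p : ℝ) ^ (1 + l) - 1) / ((p : ℝ) - 1)) ^ s ≤ budget p (1 + l) 1 s := by
  letI : Fintype (MulChar (ZMod p) ℂ) := Fintype.ofFinite _
  have hp2 : 2 ≤ p := hp.out.two_le
  have hp1R : (0 : ℝ) < (p : ℝ) - 1 := by
    have : (2 : ℝ) ≤ p := by exact_mod_cast hp2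
    linarith
  have hfin : (irrChars (GLm p (1 + l)) ∩ levelSet p (1 + l) 1).Finite :=
    (irrChars_finite_holds (GLm p (1 + l))).subset Set.inter_subset_left
  set T : Finset (Finset (MulChar (ZMod p) ℂ)) :=
    (Finset.univ.erase (1 : MulChar (ZMod p) ℂ)).powersetCard 1 with hT
  have hmemT : ∀ S ∈ T, S.card = 1 ∧ (1 : MulChar (ZMod p) ℂ) ∉ S := by
    intro S hS
    rw [Finset.mem_powersetCard] at hS
    exact ⟨hS.2, fun h1 => by simpa using hS.1 h1⟩
  have hinj : Set.InjOn (psi (p := p) 1 l) ↑T := by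
    intro S hS S' hS' e
    by_contra hne
    obtain ⟨hSk, hS1⟩ := hmemT S hS
    obtain ⟨hS'k, hS'1⟩ := hmemT S' hS'
    simp only [psi, dif_pos hSk, dif_pos hS'k] at e
    exact twChar_ne_of_ne hSk hS'k hS1 hS'1 hne e
  have hsub : T.image (psi (p := p) 1 l) ⊆ hfin.toFinset := by
    intro ψ hψ
    rw [Set.Finite.mem_toFinset]
    obtain ⟨S, hS, rfl⟩ := Finset.mem_image.mp hψ
    obtain ⟨hSk, hS1⟩ := hmemT S hS
    simp only [psi, dif_pos hSk]
    exact ⟨isIrrChar_twChar (tup_injective S hSk) (tup_ne_one hSk hS1), twChar_mem_levelSet _⟩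
  have hdeg : ∀ S ∈ T, (((p : ℝ) ^ (1 + l) - 1) / ((p : ℝ) - 1)) ^ s ≤
      ((psi (p := p) 1 l S) 1).re ^ s := by
    intro S hS
    obtain ⟨hSk, -⟩ := hmemT S hS
    simp only [psi, dif_pos hSk]
    have hex := twChar_one_mul_level_one (l := l) (tup S hSk)
    have heq : (twChar (l := l) (tup S hSk) 1).re = ((p : ℝ) ^ (1 + l) - 1) / ((p : ℝ) - 1) := by
      rw [eq_div_iff hp1R.ne', hex]
    rw [heq]
  have hcount : T.card = p - 2 := by
    rw [hT, Finset.card_powersetCard, Finset.card_erase_of_mem (Finset.mem_univ _), Finset.card_univ,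
      ← Nat.card_eq_fintype_card, card_mulChar, Nat.choose_one_right]
    omega
  have hcountR : (T.card : ℝ) = (p : ℝ) - 2 := by
    rw [hcount, Nat.cast_sub hp2]; norm_num
  calc ((p : ℝ) - 2) * (((p : ℝ) ^ (1 + l) - 1) / ((p : ℝ) - 1)) ^ s
      = ∑ S ∈ T, (((p : ℝ) ^ (1 + l) - 1) / ((p : ℝ) - 1)) ^ s := by
        rw [Finset.sum_const, nsmul_eq_mul, hcountR]
    _ ≤ ∑ S ∈ T, ((psi (p := p) 1 l S) 1).re ^ s := Finset.sum_le_sum hdeg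
    _ = ∑ ψ ∈ T.image (psi (p := p) 1 l), (ψ 1).re ^ s := by rw [Finset.sum_image hinj]
    _ ≤ ∑ ψ ∈ hfin.toFinset, (ψ 1).re ^ s :=
        Finset.sum_le_sum_of_subset_of_nonneg hsub fun ψ hψ _ =>
          Real.rpow_nonneg (re_apply_one_nonneg (hfin.mem_toFinset.mp hψ).1) s
    _ = budget p (1 + l) 1 s := by
        unfold budget
        rw [finsum_mem_eq_finite_toFinset_sum _ hfin]

/-- **THE SHARPENED LEVEL-ONE SQUEEZE** (exact floor `(p−2)[m]_p^{2+ε}`, wall ceiling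
`2V² ≤ N_1³`, `N_1 (p−1) ≤ p^{2m}`, and `p^m ≤ (p²/(p+1)) · [m]_p` for `m ≥ 2`): a level-one witness of
the crux in `GL_{1+l}(𝔽_p)`, `l ≥ 1`, forces
`(p−2)² · 2^{(2+ε)/3} · (p−1)^{2+ε} < (p²/(p+1))^{2(2+ε)}`. -/
theorem levelOne_squeeze_sharp (hl : 1 ≤ l) {ε : ℝ} (hε : 0 < ε)
    {H₁ H₂ H₃ : Subgroup (GLm p (1 + l))} (htpp : SubgroupTPP H₁ H₂ H₃)
    (hdes : ∃ c : Mat p (1 + l) → ℂ, (∀ M, 1 < M.rank → c M = 0) ∧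
      (∑ M, c M * ZMod.stdAddChar (Matrix.trace (M * ((1 : GLm p (1 + l)) : Mat p (1 + l))))) = 1 ∧
      ∀ a ∈ H₁, ∀ b ∈ H₂, ∀ g ∈ H₃, a * b * g ≠ 1 →
        (∑ M, c M * ZMod.stdAddChar
          (Matrix.trace (M * ((a * b * g : GLm p (1 + l)) : Mat p (1 + l))))) = 0)
    (hlt : budget p (1 + l) 1 (2 + ε) <
      ((Nat.card H₁ * Nat.card H₂ * Nat.card H₃ : ℕ) : ℝ) ^ ((2 + ε) / 3)) :
    ((p : ℝ) - 2) ^ 2 * (2 : ℝ) ^ ((2 + ε) / 3) * ((p : ℝ) - 1) ^ (2 + ε) <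
      ((p : ℝ) ^ 2 / ((p : ℝ) + 1)) ^ (2 * (2 + ε)) := by
  obtain ⟨-, hceil⟩ := window (k := 1) (l := l) hε htpp hdes hlt
  set s : ℝ := 2 + ε with hs_def
  have hs : 0 < s := by rw [hs_def]; linarith
  set V : ℕ := Nat.card H₁ * Nat.card H₂ * Nat.card H₃ with hV_def
  have hp2 : 2 ≤ p := hp.out.two_le
  have hpR : (2 : ℝ) ≤ p := by exact_mod_cast hp2
  have hp1 : (0 : ℝ) < (p : ℝ) - 1 := by linarith
  have hp0 : (0 : ℝ) < (p : ℝ) := by linarith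
  -- the exact degree `d = [1+l]_p`, `d (p-1) = p^{1+l} - 1`, `d ≥ p + 1`
  set d : ℝ := ((p : ℝ) ^ (1 + l) - 1) / ((p : ℝ) - 1) with hd_def
  have hd : d * ((p : ℝ) - 1) = (p : ℝ) ^ (1 + l) - 1 := by
    rw [hd_def, div_mul_cancel₀ _ hp1.ne']
  have hdp : (p : ℝ) + 1 ≤ d := by
    rw [hd_def, le_div_iff₀ hp1]
    have : (p : ℝ) ^ 2 ≤ (p : ℝ) ^ (1 + l) := pow_le_pow_right₀ (by linarith) (by omega)
    nlinarith
  have hd0 : 0 < d := by linarith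
  -- floor: `(p - 2) d^s < V^{s/3}`
  have hfl : ((p : ℝ) - 2) * d ^ s < (V : ℝ) ^ (s / 3) :=
    (budget_ge_levelOne (p := p) (l := l) s).trans_lt hlt
  -- ceiling: `2 V² (p-1)^3 ≤ p^{6(1+l)}`
  have hN := card_rankLE_one_mul_le (p := p) (m := 1 + l) (by omega)
  have hce : 2 * V ^ 2 * (p - 1) ^ 3 ≤ p ^ (6 * (1 + l)) := by
    calc 2 * V ^ 2 * (p - 1) ^ 3 ≤ (Fintype.card {M : Mat p (1 + l) // M.rank ≤ 1}) ^ 3 * (p - 1) ^ 3 :=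
          Nat.mul_le_mul_right _ hceil
      _ = (Fintype.card {M : Mat p (1 + l) // M.rank ≤ 1} * (p - 1)) ^ 3 := by ring
      _ ≤ (p ^ (2 * (1 + l))) ^ 3 := Nat.pow_le_pow_left hN 3
      _ = p ^ (6 * (1 + l)) := by rw [← pow_mul]; ring_nf
  have hceR : 2 * (V : ℝ) ^ 2 * ((p : ℝ) - 1) ^ 3 ≤ (p : ℝ) ^ (6 * (1 + l)) := by
    have h1 : (1 : ℕ) ≤ p := hp.out.one_lt.le
    have h := (Nat.cast_le (α := ℝ)).mpr hce
    push_cast [Nat.cast_sub h1] at h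
    exact h
  -- square the floor and raise the ceiling to the power `s/3`
  have hV0 : (0 : ℝ) ≤ (V : ℝ) := Nat.cast_nonneg _
  have hX : 0 < d ^ s := Real.rpow_pos_of_pos hd0 _
  have hA0 : 0 ≤ ((p : ℝ) - 2) * d ^ s := mul_nonneg (by linarith) hX.le
  have hsq : (((p : ℝ) - 2) * d ^ s) ^ 2 < ((V : ℝ) ^ 2) ^ (s / 3) := by
    have h := pow_lt_pow_left₀ hfl hA0 two_ne_zero
    have e : ((V : ℝ) ^ (s / 3)) ^ 2 = ((V : ℝ) ^ 2) ^ (s / 3) := by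
      rw [← Real.rpow_natCast ((V : ℝ) ^ (s / 3)) 2, ← Real.rpow_mul hV0,
        ← Real.rpow_natCast (V : ℝ) 2, ← Real.rpow_mul hV0]
      congr 1
      push_cast
      ring
    rwa [e] at h
  have hVsq : (V : ℝ) ^ 2 ≤ (p : ℝ) ^ (6 * (1 + l)) / (2 * ((p : ℝ) - 1) ^ 3) := by
    rw [le_div_iff₀ (by positivity)]
    linarith
  have hup : ((V : ℝ) ^ 2) ^ (s / 3) ≤ ((p : ℝ) ^ (6 * (1 + l)) / (2 * ((p : ℝ) - 1) ^ 3)) ^ (s / 3) :=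
    Real.rpow_le_rpow (by positivity) hVsq (by positivity)
  -- `(p^{6m} / (2 (p-1)^3))^{s/3} = ((p^m)^2)^s / (2^{s/3} (p-1)^s)`
  set P : ℝ := (p : ℝ) ^ (1 + l) with hP_def
  have hP0 : 0 < P := by positivity
  have hrhs : ((p : ℝ) ^ (6 * (1 + l)) / (2 * ((p : ℝ) - 1) ^ 3)) ^ (s / 3) =
      (P ^ 2) ^ s / ((2 : ℝ) ^ (s / 3) * ((p : ℝ) - 1) ^ s) := by
    rw [Real.div_rpow (by positivity) (by positivity), Real.mul_rpow (by norm_num) (by positivity)]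
    have e3 : ((p : ℝ) ^ (6 * (1 + l))) ^ (s / 3) = (P ^ 2) ^ s := by
      rw [show (p : ℝ) ^ (6 * (1 + l)) = (P ^ 2) ^ 3 by rw [hP_def]; ring,
        ← Real.rpow_natCast (P ^ 2) 3, ← Real.rpow_mul (by positivity)]
      congr 1; push_cast; ring
    have e4 : (((p : ℝ) - 1) ^ 3) ^ (s / 3) = ((p : ℝ) - 1) ^ s := by
      rw [← Real.rpow_natCast ((p : ℝ) - 1) 3, ← Real.rpow_mul hp1.le]
      congr 1; push_cast; ring
    rw [e3, e4]
  rw [hrhs] at hup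
  have hlt2 := hsq.trans_le hup
  -- `P = p^m ≤ (p²/(p+1)) d`, hence `(P^2)^s ≤ (p²/(p+1))^{2s} (d^s)^2`
  set c : ℝ := (p : ℝ) ^ 2 / ((p : ℝ) + 1) with hc_def
  have hc0 : 0 < c := by positivity
  have hPle : P ≤ c * d := by
    have h1 : P = d * ((p : ℝ) - 1) + 1 := by rw [hd]; ring
    have h2 : 1 ≤ d / ((p : ℝ) + 1) := by
      rw [le_div_iff₀ (by linarith)]; linarith
    have h3 : c * d = d * ((p : ℝ) - 1) + d / ((p : ℝ) + 1) := by
      rw [hc_def]; field_simp; ring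
    rw [h1, h3]; linarith
  have hP2 : P ^ 2 ≤ (c * d) ^ 2 := pow_le_pow_left₀ hP0.le hPle 2
  have hpow : (P ^ 2) ^ s ≤ ((c * d) ^ 2) ^ s := Real.rpow_le_rpow (by positivity) hP2 hs.le
  have hsplit : ((c * d) ^ 2) ^ s = c ^ (2 * s) * (d ^ s) ^ 2 := by
    rw [mul_pow, Real.mul_rpow (by positivity) (by positivity)]
    congr 1
    · rw [← Real.rpow_natCast c 2, ← Real.rpow_mul hc0.le]; norm_num
    · rw [← Real.rpow_natCast d 2, ← Real.rpow_mul hd0.le, ← Real.rpow_natCast (d ^ s) 2,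
        ← Real.rpow_mul hd0.le]
      congr 1; push_cast; ring
  rw [hsplit] at hpow
  -- combine
  have hden : 0 < (2 : ℝ) ^ (s / 3) * ((p : ℝ) - 1) ^ s := by positivity
  rw [lt_div_iff₀ hden] at hlt2
  have hX2 : 0 < (d ^ s) ^ 2 := by positivity
  have key : ((p : ℝ) - 2) ^ 2 * (2 : ℝ) ^ (s / 3) * ((p : ℝ) - 1) ^ s * (d ^ s) ^ 2 <
      c ^ (2 * s) * (d ^ s) ^ 2 := by nlinarith [hlt2, hpow, hX2]
  exact lt_of_mul_lt_mul_right key hX2.le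

/-- **NO LEVEL-ONE WITNESS IN ANY `GL_m(𝔽_p)`, `m ≥ 2`, BELOW THE SHARP THRESHOLD.**  If
`(p²/(p+1))^{2(2+ε)} ≤ (p−2)² 2^{(2+ε)/3} (p−1)^{2+ε}` — true for EVERY prime `p ≥ 7` and all
`0 < ε ≤ ε₁'(p)` (`ε₁'(7) ≈ 0.009`, `ε₁'(11) ≈ 0.10`, `ε₁'(13) ≈ 0.12`, `ε₁'(23) ≈ 0.13`,
`ε₁'(101) ≈ 0.10`, `ε₁'(p) ~ 2 ln 2 / (3 ln p)`), versus `p ≥ 17` for the `p^{m-1}` floor of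
`WitnessWindow.no_levelOne_witness_of_le` — then no subgroup triple of `GL_{1+l}(𝔽_p)`, `l ≥ 1`,
carrying a level-one identity design satisfies the crux inequality at `ε`. -/
theorem no_levelOne_witness_sharp (hl : 1 ≤ l) {ε : ℝ} (hε : 0 < ε)
    (hthr : ((p : ℝ) ^ 2 / ((p : ℝ) + 1)) ^ (2 * (2 + ε)) ≤
      ((p : ℝ) - 2) ^ 2 * (2 : ℝ) ^ ((2 + ε) / 3) * ((p : ℝ) - 1) ^ (2 + ε))
    {H₁ H₂ H₃ : Subgroup (GLm p (1 + l))} (htpp : SubgroupTPP H₁ H₂ H₃)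
    (hdes : ∃ c : Mat p (1 + l) → ℂ, (∀ M, 1 < M.rank → c M = 0) ∧
      (∑ M, c M * ZMod.stdAddChar (Matrix.trace (M * ((1 : GLm p (1 + l)) : Mat p (1 + l))))) = 1 ∧
      ∀ a ∈ H₁, ∀ b ∈ H₂, ∀ g ∈ H₃, a * b * g ≠ 1 →
        (∑ M, c M * ZMod.stdAddChar
          (Matrix.trace (M * ((a * b * g : GLm p (1 + l)) : Mat p (1 + l))))) = 0) :
    ¬ budget p (1 + l) 1 (2 + ε) <
      ((Nat.card H₁ * Nat.card H₂ * Nat.card H₃ : ℕ) : ℝ) ^ ((2 + ε) / 3) :=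
  fun hlt => absurd (levelOne_squeeze_sharp hl hε htpp hdes hlt) (not_lt.mpr hthr)

end ZModP

end LevelOneDegree
end Summit.MatrixMultiplication.MatrixMultiplication.Theorems.SubgroupIdentityDesigns.Negative

end
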